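import Summits.QuantumFields.YangMills.Theorems.BalabanUVNodesN06SectBClassKnitHclass

/-!
# Balaban UV-stability nodes, N06 [B9] Sect. B — «K2-G-KNIT-N» (1∕4): THE KNIT SECT.-B JUNCTION FOR A GAUGE GROUP CLOSED UNDER AVERAGING AT A RADIUS `t`
# (`AvgClosedAt (d+1) t (ℓ+1) G`, [5] Prop. 2 localized) — the `N`-CAP-FREE edition of gen 26's `…N06SectBStepUParKnit` (which asked `AvgClosed`, i.e. `N ≦ 25` at `SU(N)`)

[B9] = T. Bałaban, *Propagators for lattice gauge theories in a background field*, Commun. Math. Phys. **99** (1985) 389–434 [`Balaban1985BackgroundPropagators`];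
[5] = T. Bałaban, *Averaging operations for lattice gauge theories*, Commun. Math. Phys. **98** (1985) 17–51 [`Balaban1985Averaging`]; [4] = [`Balaban1984PropagatorsII`].

statement-level skeleton of published theorems with citation tags; proofs where landed; nothing here is a claim about the Yang–Mills mass gap

THE PRINT.  Thm 3.4 p. 400 (the Sect.-B step on (3.35)–(3.37)); (3.19) p. 393 (the averaging's transporters are [5]'s (52)–(53)); [5] Prop. 2 p. 26: the averaged variables stay in
the group on the small-field class — print has NO restriction on `N`.

WHY (seat dag-n06-c gen 27; cell `pub-ymgap`, HUMAN RULING D-0062, Track A node N06).  Gen 26's junction `sectBStepUPar_knit_of_laws` asks `hGa : AvgClosed (d+1) (ℓ+1) G` (closure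
under ALL block averages of (52)-regular fields), which the tree has for `SU(N)` only at `N ≦ 25` (`B7AvgClosedSpecialUnitarySharp.avgClosed_specialUnitary_of_le`) and REFUTES at
`N ≧ 26` (`B7Prop2SpecialUnitary.not_avgClosed_specialUnitary`) — the programme's LOCATED-RANGE, displayed as `hN : N ≤ 25` in the knit certificate's `hBK` fold
(`…KnitRecordKC`, KE₃X).  dag-n06-l's edition 2 `B9Eq3124HZKnitPairReg335YMemG.parKnitY_mem_of_reg335P_at` (✓, 2026-08-31) gives the knit legs in `G` for `G` closed AT A RADIUS
`t ≥ 32((d+1)+1)((d+1)+4)(ℓ+1)²α₀′` — and `SU(N)` is closed at every radius `t ≤ 1∕4` with `N·t < π` (`avgClosedAt_specialUnitary`), for EVERY `N`.  THIS FILE re-reads gen 26's §1–§2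
through it: every `hGa : AvgClosed …` becomes `hGa : AvgClosedAt (d+1) t (ℓ+1) G` plus the one x-free window `hαt : 32((d+1)+1)((d+1)+4)(ℓ+1)²α₀′ ≤ t`; proofs VERBATIM with
`parKnitY_mem_of_reg335P ↦ parKnitY_mem_of_reg335P_at`.  The old statements are the instances `t := 1∕4` (`B7Prop2SpecialUnitary.avgClosedAt_of_avgClosed`).
* §1 ★ `parKnitY_mem_of_reg335C_at` (the junction's guarded `hparG`), `parMemY_parKnitY_at` (the knit class's `ParMemY` law), `isUnit_deltaPrimeAY_parKnitY_of_reg335C_at`,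
  `isUnit_XY_parKnitY_of_reg335C_at`.
* §2 ★★★ `sectBStepUPar_knit_of_lawsAt` — gen 26's `sectBStepUPar_knit_of_laws` at `AvgClosedAt`.
* §3 ★★★ `hclass_C37KY_knitAt` — gen 26's `N06SectBClassKnitHclass.hclass_C37KY_knit` (the knit class CONTAINS the record's (3.37) pairs over regular bases) at `AvgClosedAt`.
HONEST SCOPE.  Instantiation of landed theorems; conditional on the displayed knit laws and Thms 3.2∕3.3; a HELPER by key 27364 — NOT the discharge of any N06 obligation;
count-neutral; nothing continuum ∕ OS ∕ mass gap ∕ Clay.  2026-08-31.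
-/

noncomputable section

namespace Summit.QuantumFields.YangMills.BalabanUVNodes.N06SectBStepUParKnitAt

open scoped Matrix Matrix.Norms.L2Operator
open Literature.MathematicalPhysics.QuantumFieldTheory.Balaban1983to89
open Literature.MathematicalPhysics.QuantumFieldTheory.Balaban1983to89.Node00 (SiteY BlkY FBondY IBondY CfgY SiteParY GAQY GpY XY deltaAQY deltaPrimeAY parSymY parBY)
open Literature.MathematicalPhysics.QuantumFieldTheory.Balaban1983to89.Node00.OpsYQLetter (adjTrY)
open Literature.MathematicalPhysics.QuantumFieldTheory.Balaban1983to89.B6Ineq2142KLevelV1 (β)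
open Literature.MathematicalPhysics.QuantumFieldTheory.Balaban1983to89.B6KLevelCensusIndexV1 (KIdx kGeo)
open Literature.MathematicalPhysics.QuantumFieldTheory.Balaban1983to89.B6RandomWalk (HasMajorant Ineq261)
open Literature.MathematicalPhysics.QuantumFieldTheory.Balaban1983to89.B6RandomWalkL2 (HasL2Majorant)
open Literature.MathematicalPhysics.QuantumFieldTheory.Balaban1983to89.B9Thm34Ext (toB6)
open Literature.MathematicalPhysics.QuantumFieldTheory.Balaban1983to89.B9PinMembersKLevelV1 (MemberY geo9Y)
open Literature.MathematicalPhysics.QuantumFieldTheory.Balaban1983to89.B9BackgroundsKLevelV1P (bg9KP)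
open Literature.MathematicalPhysics.QuantumFieldTheory.Balaban1983to89.B9SectBCodedClassR (RegExtraY bg9YC extraYPb)
open Literature.MathematicalPhysics.QuantumFieldTheory.Balaban1983to89.B9Eq360DeltaPrimeAY (AfldY)
open Literature.MathematicalPhysics.QuantumFieldTheory.Balaban1983to89.B9SectBGpLettersY (GVal blkC)
open Literature.MathematicalPhysics.QuantumFieldTheory.Balaban1983to89.B9SectBGpFrameCodedYR (codingYx)
open Literature.MathematicalPhysics.QuantumFieldTheory.Balaban1983to89.B9SectBGpFrameCodedY (CplxLettersY exists_d261)
open Literature.MathematicalPhysics.QuantumFieldTheory.Balaban1983to89.B9SectBCodedReadingsUR (KACU)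
open Literature.MathematicalPhysics.QuantumFieldTheory.Balaban1983to89.B9SectBCodedReadingsUParH (KSCUPar SectBStepUPar)
open Literature.MathematicalPhysics.QuantumFieldTheory.Balaban1983to89.B9SectBKerFrameCodedYR (CinvY)
open Literature.MathematicalPhysics.QuantumFieldTheory.Balaban1983to89.B9RWSumsReadsNbr (nbr)
open Literature.MathematicalPhysics.QuantumFieldTheory.Balaban1983to89.B9SectBGClassLettersY (CplxLettersGY)
open Literature.MathematicalPhysics.QuantumFieldTheory.Balaban1983to89.B9Eq340TaxiContourLocalityY (rLB)
open Literature.MathematicalPhysics.QuantumFieldTheory.Balaban1983to89.B9SectBGReg335PlaqYOfClassPb (c335Plaq c335Plaq_nonneg hreg335P_extraYPb)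
open Literature.MathematicalPhysics.QuantumFieldTheory.Balaban1983to89.B9SectBL2GCrossY (plaqLawY_of_reg335PlaqY)
open Literature.MathematicalPhysics.QuantumFieldTheory.Balaban1983to89.B9SectBGFramesSelQY (gFrame₅CodedOnSelQ)
open Literature.MathematicalPhysics.QuantumFieldTheory.Balaban1983to89.B9SectBGWordDeltaAQY (F₂QC F₂sQC)
open Literature.MathematicalPhysics.QuantumFieldTheory.Balaban1983to89.B9SectBQLettersL2QY (F₂QC2 F₂sQC2)
open Literature.MathematicalPhysics.QuantumFieldTheory.Balaban1983to89.B9SectBStepUParGQOfMembers (sectBStepUParGQ_parSymYH_of_members)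
open Literature.MathematicalPhysics.QuantumFieldTheory.Balaban1983to89.B9SectBCodedClassKnitY (C37KY ParMemY hC37_of_C37KY hparC_of_C37KY hC37G_of_C37KY)
open Literature.MathematicalPhysics.QuantumFieldTheory.Balaban1983to89.B7Prop2Explicit (unitaryUnits AvgClosed mem_unitaryUnits)
open Literature.MathematicalPhysics.QuantumFieldTheory.Balaban1983to89.B9Eq316AveragingTransposeZd (alphaQ)
open Literature.MathematicalPhysics.QuantumFieldTheory.Balaban1983to89.B9Eq3115KnitLetterY (QknitY)
open Literature.MathematicalPhysics.QuantumFieldTheory.Balaban1983to89.B9C2FormBoxRegimeY (Kpl)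
open Literature.MathematicalPhysics.QuantumFieldTheory.Balaban1983to89.B9Eq3115KnitLetterYOnto (kCol kCol_nonneg)
open Literature.MathematicalPhysics.QuantumFieldTheory.Balaban1983to89.B9B8KnitColumnFlatness (windows_of_alphaQ)
open Literature.MathematicalPhysics.QuantumFieldTheory.Balaban1983to89.B9B8AveragingJunction (parKnitY parKnitY_inv)
open Literature.MathematicalPhysics.QuantumFieldTheory.Balaban1983to89.B9Eq3124HZKnitPairReg335YMemG (parKnitY_mem_of_reg335P_at)
open Literature.MathematicalPhysics.QuantumFieldTheory.Balaban1983to89.B7Prop2SpecialUnitary (AvgClosedAt)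
open Summit.QuantumFields.YangMills.BalabanUVNodes.N06SectBStepUParKnit (norm_le_one_of_le_unitaryUnits)
open Literature.MathematicalPhysics.QuantumFieldTheory.Balaban1983to89.B9SectBCodedClassKnitYC (hclass_C37KY_onC)
open Literature.MathematicalPhysics.QuantumFieldTheory.Balaban1983to89.B9Eq358KnitTransporterVariationY (parVar337Y_parKnitY)
open Literature.MathematicalPhysics.QuantumFieldTheory.Balaban1983to89.B7Prop2Explicit (C0 c2')
open Literature.MathematicalPhysics.QuantumFieldTheory.Balaban1983to89.B7Prop3Flat (c3)
open Literature.MathematicalPhysics.QuantumFieldTheory.Balaban1983to89.B9Thm311PositivityKnitLetter (isUnit_deltaPrimeAY_parKnitY)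
open Literature.MathematicalPhysics.QuantumFieldTheory.Balaban1983to89.B9B8KnitLetterProjectionC (isUnit_XY_parKnitY)
open Summit.QuantumFields.YangMills.BalabanUVNodes.N06SectBQLawsKnitMembers (hQ15_knit hQL2_knit)

variable {d ℓ : ℕ} {hd : 1 ≤ d + 1} {hL : Odd (ℓ + 1) ∧ 1 < ℓ + 1} {b₀ b₁ : ℝ}
variable {N : ℕ} [Nonempty (Fin N)] {ι : Type} [Fintype ι] [DecidableEq ι]
variable {Mstar : ℕ} {J : Type} (f : J → MemberY d ℓ hd hL b₀ b₁ Mstar)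
  [∀ x : MemberY d ℓ hd hL b₀ b₁ Mstar, Fintype (geo9Y x).Site]
  [instDS : ∀ x : MemberY d ℓ hd hL b₀ b₁ Mstar, DecidableEq (geo9Y x).Site] [instNE : ∀ x : MemberY d ℓ hd hL b₀ b₁ Mstar, Nonempty (geo9Y x).Site]
  (c35 : ℝ) (G : Subgroup (Matrix (Fin N) (Fin N) ℂ)ˣ)
  (𝔮 : ∀ j : J, CfgY (Matrix (Fin N) (Fin N) ℂ) (f j).toKIdx → ((FBondY (f j).toKIdx → Matrix (Fin N) (Fin N) ℂ) →ₗ[ℂ] (IBondY (f j).toKIdx → Matrix (Fin N) (Fin N) ℂ)))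
  (𝔮s : ∀ j : J, CfgY (Matrix (Fin N) (Fin N) ℂ) (f j).toKIdx → ((IBondY (f j).toKIdx → Matrix (Fin N) (Fin N) ℂ) →ₗ[ℂ] (FBondY (f j).toKIdx → Matrix (Fin N) (Fin N) ℂ)))
  (b : Module.Basis ι ℝ (Matrix (Fin N) (Fin N) ℂ)) (ιB : ∀ j : J, BlkY (f j).toKIdx → IBondY (f j).toKIdx)
  (C38 : ∀ j : J, ℝ → CfgY (Matrix (Fin N) (Fin N) ℂ) (f j).toKIdx → AfldY (Matrix (Fin N) (Fin N) ℂ) (f j).toKIdx → Prop)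
  (R : ∀ j : J, ℝ → CfgY (Matrix (Fin N) (Fin N) ℂ) (f j).toKIdx → Prop) (Cq CqK MK aK β₀ : ℝ)

/-! ## §1 The averaging-transporter laws of the junction at the knit, for a group closed at a radius `t` -/

section ParLaws

variable {MInv aInv : ℝ} {c₀ α₀' : ℝ}

omit [Fintype ι] [DecidableEq ι] [∀ x : MemberY d ℓ hd hL b₀ b₁ Mstar, Fintype (geo9Y x).Site] instDS instNE in
/-- ★ **THE JUNCTION's GUARDED MEMBERSHIP LAW `hparG` AT `parA := parKnitY`**: above `M_inv ≦ M`, at a (3.35)-regular base of the coded class (bridged by `hRP` to the local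
class `(bg9KP M_N(ℂ) G i).Reg335 c₀`, `c₀ ≦ 10`) with `M·α₀ ≦ a_inv` inside the knit numerics window (`α₀′ ≦ α_Q`, `K_pl(a)·L⁴ < α₀′` for `a ≦ a_inv`), the whole knit
table `parKnitY U` is `G`-valued, `G ≤ U(N)` averaging-closed AT A RADIUS `t ≥ 32((d+1)+1)((d+1)+4)(ℓ+1)²α₀′` — dag-n06-l's `parKnitY_mem_of_reg335P_at` (edition 2): NO `N`-cap when `G = SU(N)`.
[cite: Balaban1985BackgroundPropagators, (3.19) p.393, (3.35) p.396; Balaban1985Averaging, Prop. 2 p.26, (52)–(53) p.27] -/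
theorem parKnitY_mem_of_reg335C_at (P : RegExtraY d ℓ hd hL b₀ b₁ Mstar (Matrix (Fin N) (Fin N) ℂ))
    {t : ℝ} (hGa : AvgClosedAt (d + 1) t (ℓ + 1) G) (hGU : G ≤ unitaryUnits (Matrix (Fin N) (Fin N) ℂ))
    (hMInv : 0 < MInv) (hc : c₀ ≤ 10)
    (hRP : ∀ (j : J) (α₀ : ℝ) (U : CfgY (Matrix (Fin N) (Fin N) ℂ) (f j).toKIdx),
      (bg9YC (Matrix (Fin N) (Fin N) ℂ) G P (f j)).Reg335 c35 α₀ U → (bg9KP (Matrix (Fin N) (Fin N) ℂ) G (f j).toKIdx).Reg335 c₀ α₀ U)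
    (hα' : 0 < α₀') (hαQ : α₀' ≤ alphaQ (d + 1) (ℓ + 1))
    (hαt : 32 * (((d + 1 : ℕ) : ℝ) + 1) * ((d + 1 : ℕ) + 4) * (((ℓ + 1 : ℕ) : ℝ)) ^ 2 * α₀' ≤ t)
    (hKpl : ∀ (j : J) (a : ℝ), 0 ≤ a → a ≤ aInv → Kpl (f j).toKIdx a * (kGeo (f j).toKIdx).L ^ 4 < α₀') :
    ∀ j (α₀ : ℝ) (U : CfgY (Matrix (Fin N) (Fin N) ℂ) (f j).toKIdx), MInv ≤ (geo9Y (f j)).M → 0 < α₀ → (geo9Y (f j)).M * α₀ ≤ aInv →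
      (bg9YC (Matrix (Fin N) (Fin N) ℂ) G P (f j)).Reg335 c35 α₀ U → ∀ z w : SiteY (f j).toKIdx, parKnitY (f j).toKIdx U z w ∈ G := by
  intro j α₀ U hM hα₀ hMa hU z w
  have hMx : 0 ≤ (geo9Y (f j)).M := hMInv.le.trans hM
  have hMα : 0 ≤ (kGeo (f j).toKIdx).M * α₀ := mul_nonneg hMx hα₀.le
  obtain ⟨hα3, hα2, -⟩ := windows_of_alphaQ (D := d + 1) hL.2 (Nat.succ_pos d) hα' hαQ
  exact parKnitY_mem_of_reg335P_at (f j).toKIdx hGa (norm_le_one_of_le_unitaryUnits G hGU) U hc hMα (hRP j α₀ U hU) hα' hα3 hα2 hαt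
    (hKpl j _ hMα hMa) z w


omit [Fintype ι] [DecidableEq ι] instDS instNE in
/-- **THE DISPLAYED MEMBERSHIP LAW `ParMemY` OF THE KNIT CLASS FILE, INHABITED AT THE KNIT** for the regularity predicate `(bg9KP M_N(ℂ) G i).Reg335 c₀` at one index above
`0 ≦ M` (one of the two laws `B9SectBCodedClassKnitY.hclass_C37KY_at` asks; the other — the knit (3.58), `ParVar337Y` — is dag-n06-l's (K1)).
[cite: Balaban1985BackgroundPropagators, (3.19) p.393, (3.35) p.396; Balaban1985Averaging, Prop. 2 p.26] -/
theorem parMemY_parKnitY_at (i : KIdx d ℓ hd hL b₀ b₁) {t : ℝ} (hGa : AvgClosedAt (d + 1) t (ℓ + 1) G) (hGU : G ≤ unitaryUnits (Matrix (Fin N) (Fin N) ℂ))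
    (hM : 0 ≤ (kGeo i).M) (hc : c₀ ≤ 10) (hα' : 0 < α₀') (hαQ : α₀' ≤ alphaQ (d + 1) (ℓ + 1))
    (hαt : 32 * (((d + 1 : ℕ) : ℝ) + 1) * ((d + 1 : ℕ) + 4) * (((ℓ + 1 : ℕ) : ℝ)) ^ 2 * α₀' ≤ t)
    (hKpl : ∀ a : ℝ, 0 ≤ a → a ≤ aInv → Kpl i a * (kGeo i).L ^ 4 < α₀') :
    ParMemY G i (parKnitY i) (fun α₀ U => (bg9KP (Matrix (Fin N) (Fin N) ℂ) G i).Reg335 c₀ α₀ U) aInv := by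
  intro α₀ U hα₀ hMa hreg z w
  have hMα : 0 ≤ (kGeo i).M * α₀ := mul_nonneg hM hα₀.le
  obtain ⟨hα3, hα2, -⟩ := windows_of_alphaQ (D := d + 1) hL.2 (Nat.succ_pos d) hα' hαQ
  exact parKnitY_mem_of_reg335P_at i hGa (norm_le_one_of_le_unitaryUnits G hGU) U hc hMα hreg hα' hα3 hα2 hαt (hKpl _ hMα hMa) z w


omit [Fintype ι] [DecidableEq ι] [∀ x : MemberY d ℓ hd hL b₀ b₁ Mstar, Fintype (geo9Y x).Site] instDS instNE in
/-- ★ **THE JUNCTION's GUARDED `hunitG` AT THE KNIT**: `Δ′_a(U; parKnitY)` is a unit at the regular bases above the thresholds (Thm 3.11's «obvious» positivity,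
`isUnit_deltaPrimeAY_parKnitY`, fed by `parKnitY_mem_of_reg335C`). [cite: Balaban1985BackgroundPropagators, (3.24) p.394, Thm 3.11 p.416, (3.35) p.396] -/
theorem isUnit_deltaPrimeAY_parKnitY_of_reg335C_at (P : RegExtraY d ℓ hd hL b₀ b₁ Mstar (Matrix (Fin N) (Fin N) ℂ))
    {t : ℝ} (hGa : AvgClosedAt (d + 1) t (ℓ + 1) G) (hGU : G ≤ unitaryUnits (Matrix (Fin N) (Fin N) ℂ))
    (hMInv : 0 < MInv) (hc : c₀ ≤ 10)
    (hRP : ∀ (j : J) (α₀ : ℝ) (U : CfgY (Matrix (Fin N) (Fin N) ℂ) (f j).toKIdx),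
      (bg9YC (Matrix (Fin N) (Fin N) ℂ) G P (f j)).Reg335 c35 α₀ U → (bg9KP (Matrix (Fin N) (Fin N) ℂ) G (f j).toKIdx).Reg335 c₀ α₀ U)
    (hα' : 0 < α₀') (hαQ : α₀' ≤ alphaQ (d + 1) (ℓ + 1))
    (hαt : 32 * (((d + 1 : ℕ) : ℝ) + 1) * ((d + 1 : ℕ) + 4) * (((ℓ + 1 : ℕ) : ℝ)) ^ 2 * α₀' ≤ t)
    (hKpl : ∀ (j : J) (a : ℝ), 0 ≤ a → a ≤ aInv → Kpl (f j).toKIdx a * (kGeo (f j).toKIdx).L ^ 4 < α₀') :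
    ∀ j (α₀ : ℝ) (U : CfgY (Matrix (Fin N) (Fin N) ℂ) (f j).toKIdx), MInv ≤ (geo9Y (f j)).M → 0 < α₀ → (geo9Y (f j)).M * α₀ ≤ aInv →
      (bg9YC (Matrix (Fin N) (Fin N) ℂ) G P (f j)).Reg335 c35 α₀ U → IsUnit (deltaPrimeAY (f j).toKIdx (parKnitY (f j).toKIdx) U) :=
  fun j α₀ U hM hα₀ hMa hU =>
    isUnit_deltaPrimeAY_parKnitY (f j).toKIdx hGU hU.1.1 (parKnitY_mem_of_reg335C_at f c35 G P hGa hGU hMInv hc hRP hα' hαQ hαt hKpl j α₀ U hM hα₀ hMa hU)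


omit [Fintype ι] [DecidableEq ι] [∀ x : MemberY d ℓ hd hL b₀ b₁ Mstar, Fintype (geo9Y x).Site] instDS instNE in
/-- ★ **THE JUNCTION's GUARDED `hunitXG` AT THE KNIT**: `Q′G′²Q′*(U; parKnitY)` is a unit at the regular bases above the thresholds (`isUnit_XY_parKnitY`).
[cite: Balaban1985BackgroundPropagators, p.395, Thm 3.11 p.416, (3.35) p.396] -/
theorem isUnit_XY_parKnitY_of_reg335C_at (P : RegExtraY d ℓ hd hL b₀ b₁ Mstar (Matrix (Fin N) (Fin N) ℂ))
    {t : ℝ} (hGa : AvgClosedAt (d + 1) t (ℓ + 1) G) (hGU : G ≤ unitaryUnits (Matrix (Fin N) (Fin N) ℂ))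
    (hMInv : 0 < MInv) (hc : c₀ ≤ 10)
    (hRP : ∀ (j : J) (α₀ : ℝ) (U : CfgY (Matrix (Fin N) (Fin N) ℂ) (f j).toKIdx),
      (bg9YC (Matrix (Fin N) (Fin N) ℂ) G P (f j)).Reg335 c35 α₀ U → (bg9KP (Matrix (Fin N) (Fin N) ℂ) G (f j).toKIdx).Reg335 c₀ α₀ U)
    (hα' : 0 < α₀') (hαQ : α₀' ≤ alphaQ (d + 1) (ℓ + 1))
    (hαt : 32 * (((d + 1 : ℕ) : ℝ) + 1) * ((d + 1 : ℕ) + 4) * (((ℓ + 1 : ℕ) : ℝ)) ^ 2 * α₀' ≤ t)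
    (hKpl : ∀ (j : J) (a : ℝ), 0 ≤ a → a ≤ aInv → Kpl (f j).toKIdx a * (kGeo (f j).toKIdx).L ^ 4 < α₀') :
    ∀ j (α₀ : ℝ) (U : CfgY (Matrix (Fin N) (Fin N) ℂ) (f j).toKIdx), MInv ≤ (geo9Y (f j)).M → 0 < α₀ → (geo9Y (f j)).M * α₀ ≤ aInv →
      (bg9YC (Matrix (Fin N) (Fin N) ℂ) G P (f j)).Reg335 c35 α₀ U →
      IsUnit (XY (f j).toKIdx (parKnitY (f j).toKIdx) (GpY (f j).toKIdx (parKnitY (f j).toKIdx)) U) :=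
  fun j α₀ U hM hα₀ hMa hU =>
    isUnit_XY_parKnitY (f j).toKIdx hGU hU.1.1 (parKnitY_mem_of_reg335C_at f c35 G P hGa hGU hMInv hc hRP hα' hαQ hαt hKpl j α₀ U hM hα₀ hMa hU)


end ParLaws

/-! ## §2 ★★★ The Sect.-B step at the knit transporter for a group closed at a radius `t` -/

section Knit

/-- ★★★ **THE TWO-TRANSPORTER SECT.-B STEP OVER THE CODED CARRIER AT THE KNIT TRANSPORTER `parKnitY`, THE KNIT CLASS `C37KY`, `P := extraYPb`, `𝔸 = M_N(ℂ)`** — gen 25's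
`sectBStepUParGQ_parSymYH_of_members` with `hsym ∕ hparG ∕ hunitG ∕ hunitXG` (knit lemmas), `hC37 ∕ hparC ∕ hC37G` (projections of `C37KY`), `hQ15 ∕ hQL2` (`hQ15_knit ∕ hQL2_knit`,
constants `κQ ∕ κQ2` of that file), `hreg335P ∕ hplaq` (`extraYPb`) and the Lemma-2.1 datum (`exists_d261` at the frame's own threshold) DISCHARGED.  DISPLAYED: `hι`, `hGa hGU`,
the basis data `M₂ hrepr hcR hcL`, the knit faces `h𝔮 h𝔮s`, the numerics window `MInv aInv aW c₀ α₀′` (`hMInv haInv haW hc hRP hα' hαQ hKpl hMd hMr mN hnbr`), the class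
constants `R Cq CqK MK aK β₀` (`hCqK`), the GUARDED knit Thm 3.11 unit `hunitA`, `hb₁`, the knit (3.80) variations `hQ80 ∕ hQL280` (constants `cF ∕ cF2`) at the class
`C37KY`, the record's Thm 3.2 `h32` and the coded Thm 3.3 `h33`.
[cite: Balaban1985BackgroundPropagators, Thm 3.4 p.400, Sect. B pp.400–407, (3.19) p.393, (3.21) p.394, (3.35)–(3.37) p.396, (3.40) p.397, Thms 3.1–3.3 pp.397–399, Thm 3.11 p.416; Balaban1985Averaging, Prop. 2 p.26; Balaban1984PropagatorsII, Lemma 2.1 p.234, (2.51) p.232] -/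
theorem sectBStepUPar_knit_of_lawsAt [NormOneClass (Matrix (Fin N) (Fin N) ℂ)] [FiniteDimensional ℝ (Matrix (Fin N) (Fin N) ℂ)]
    (hι : ∀ (j : J) (s : BlkY (f j).toKIdx), β (f j).toKIdx.hN (f j).toKIdx.D (f j).toKIdx.hk (ιB j s) = s)
    {t : ℝ} (hGa : AvgClosedAt (d + 1) t (ℓ + 1) G) (hGU : G ≤ unitaryUnits (Matrix (Fin N) (Fin N) ℂ))
    (M₂ : ℝ) (hM₂ : 0 ≤ M₂) (hrepr : ∀ (v : Matrix (Fin N) (Fin N) ℂ) (j : ι), |b.repr v j| ≤ M₂ * ‖v‖) (hcR : 0 < M₂ * ∑ j, ‖b j‖)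
    (hcL : 0 < Real.sqrt (Fintype.card ι) * M₂ * ∑ j, ‖b j‖)
    (h𝔮 : ∀ (j : J) (U : CfgY (Matrix (Fin N) (Fin N) ℂ) (f j).toKIdx), 𝔮 j U = QknitY (f j).toKIdx U)
    (h𝔮s : ∀ (j : J) (U : CfgY (Matrix (Fin N) (Fin N) ℂ) (f j).toKIdx), 𝔮s j U = adjTrY (QknitY (f j).toKIdx U))
    (hCqK : 0 ≤ CqK)
    (MInv aInv aW : ℝ) (hMInv : 0 < MInv) (haInv : 0 < aInv) (haW : 0 < aW) {c₀ : ℝ} (hc : c₀ ≤ 10)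
    (hRP : ∀ (j : J) (α₀ : ℝ) (U : CfgY (Matrix (Fin N) (Fin N) ℂ) (f j).toKIdx),
      (bg9YC (Matrix (Fin N) (Fin N) ℂ) G (extraYPb (Matrix (Fin N) (Fin N) ℂ) G) (f j)).Reg335 c35 α₀ U →
        (bg9KP (Matrix (Fin N) (Fin N) ℂ) G (f j).toKIdx).Reg335 c₀ α₀ U)
    {α₀' : ℝ} (hα' : 0 < α₀') (hαQ : α₀' ≤ alphaQ (d + 1) (ℓ + 1))
    (hαt : 32 * (((d + 1 : ℕ) : ℝ) + 1) * ((d + 1 : ℕ) + 4) * (((ℓ + 1 : ℕ) : ℝ)) ^ 2 * α₀' ≤ t)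
    (hKpl : ∀ (j : J) (a : ℝ), 0 ≤ a → a ≤ aInv → Kpl (f j).toKIdx a * (kGeo (f j).toKIdx).L ^ 4 < α₀')
    (hunitA : ∀ j (α₀ : ℝ) (U : CfgY (Matrix (Fin N) (Fin N) ℂ) (f j).toKIdx), MInv ≤ (geo9Y (f j)).M → 0 < α₀ → (geo9Y (f j)).M * α₀ ≤ aInv →
      (bg9YC (Matrix (Fin N) (Fin N) ℂ) G (extraYPb (Matrix (Fin N) (Fin N) ℂ) G) (f j)).Reg335 c35 α₀ U →
      IsUnit (deltaAQY (f j).toKIdx (𝔮 j) (𝔮s j) (parKnitY (f j).toKIdx) (GpY (f j).toKIdx (parKnitY (f j).toKIdx)) U)) (hb₁ : 0 ≤ b₁)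
    (cF : ℝ) (hcF : 0 ≤ cF)
    (hQ80 : ∀ j (β' : ℝ) (U : CfgY (Matrix (Fin N) (Fin N) ℂ) (f j).toKIdx) (a : AfldY (Matrix (Fin N) (Fin N) ℂ) (f j).toKIdx), 0 < β' →
      C37KY G (f j) (ιB j) (R j) Cq CqK MK aK β₀ β' U a → ∀ δ : ℝ, 0 < δ → δ ≤ 1 →
      HasMajorant (g := toB6 (geo9Y (f j)) 0 True) (fun q : (Fin (d + 1) × SiteY (f j).toKIdx) × ι => blkC (f j).toKIdx (ιB j) q.1.2)
          (F₂QC (f j).toKIdx (𝔮 j) b (.base U) (.mult a)) (fun a₁ a₂ => cF * β' * Real.exp (-(δ * (geo9Y (f j)).dist a₁ a₂))) ∧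
        HasMajorant (g := toB6 (geo9Y (f j)) 0 True) (fun q : (Fin (d + 1) × SiteY (f j).toKIdx) × ι => blkC (f j).toKIdx (ιB j) q.1.2)
          (F₂sQC (f j).toKIdx (𝔮s j) b (.base U) (.mult a)) (fun a₁ a₂ => cF * β' * Real.exp (-(δ * (geo9Y (f j)).dist a₁ a₂))))
    (cF2 : ℝ) (hcF2 : 0 ≤ cF2)
    (hQL280 : ∀ j (β' : ℝ) (U : CfgY (Matrix (Fin N) (Fin N) ℂ) (f j).toKIdx) (a : AfldY (Matrix (Fin N) (Fin N) ℂ) (f j).toKIdx), 0 < β' →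
      C37KY G (f j) (ιB j) (R j) Cq CqK MK aK β₀ β' U a → ∀ δ : ℝ, 0 < δ → δ ≤ 1 →
      HasL2Majorant (g := toB6 (geo9Y (f j)) 0 True) (fun q : (Fin (d + 1) × SiteY (f j).toKIdx) × ι => blkC (f j).toKIdx (ιB j) q.1.2)
          (F₂QC2 (f j).toKIdx (𝔮 j) b (.base U) (.mult a)) (fun a₁ a₂ => cF2 * β' * Real.exp (-(δ * (geo9Y (f j)).dist a₁ a₂))) ∧
        HasL2Majorant (g := toB6 (geo9Y (f j)) 0 True) (fun q : (Fin (d + 1) × SiteY (f j).toKIdx) × ι => blkC (f j).toKIdx (ιB j) q.1.2)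
          (F₂sQC2 (f j).toKIdx (𝔮s j) b (.base U) (.mult a)) (fun a₁ a₂ => cF2 * β' * Real.exp (-(δ * (geo9Y (f j)).dist a₁ a₂))))
    (hMd : 2 * ((d : ℝ) + 1) < MInv) (mN : ℕ) (hnbr : ∀ (j : J) (y' : IBondY (f j).toKIdx), (nbr (geo9Y (f j)) (2 * ((d : ℝ) + 1)) y').card ≤ mN)
    (hMr : rLB d ℓ + 1 < MInv)
    (h32 : B9.Thm32Printed (d + 1) c35 (fun j => geo9Y (f j)) (fun j => bg9YC (Matrix (Fin N) (Fin N) ℂ) G (extraYPb (Matrix (Fin N) (Fin N) ℂ) G) (f j))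
      (CinvY (extraYPb (Matrix (Fin N) (Fin N) ℂ) G) f G (fun j => parKnitY (f j).toKIdx)))
    (h33 : B9.Thm33Printed c35 (fun j => geo9Y (f j))
      (fun j => (codingYx (extraYPb (Matrix (Fin N) (Fin N) ℂ) G) G (f j) (C37KY G (f j) (ιB j) (R j) Cq CqK MK aK β₀) (C38 j)).bg)
      (fun j => KSCUPar (extraYPb (Matrix (Fin N) (Fin N) ℂ) G) G (f j) (parKnitY (f j).toKIdx) (parSymY (f j).toKIdx)
        (C37KY G (f j) (ιB j) (R j) Cq CqK MK aK β₀) (C38 j))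
      (fun j => KACU (extraYPb (Matrix (Fin N) (Fin N) ℂ) G) G (f j)
        (GAQY (f j).toKIdx (𝔮 j) (𝔮s j) (parKnitY (f j).toKIdx) (GpY (f j).toKIdx (parKnitY (f j).toKIdx))) (parBY (f j).toKIdx)
        (C37KY G (f j) (ιB j) (R j) Cq CqK MK aK β₀) (C38 j))) :
    SectBStepUPar (extraYPb (Matrix (Fin N) (Fin N) ℂ) G) f (d + 1) c35 G b (fun j => parKnitY (f j).toKIdx) (fun j => parSymY (f j).toKIdx)
      (fun j => GAQY (f j).toKIdx (𝔮 j) (𝔮s j) (parKnitY (f j).toKIdx) (GpY (f j).toKIdx (parKnitY (f j).toKIdx)))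
      (fun j => parBY (f j).toKIdx) (fun j => C37KY G (f j) (ιB j) (R j) Cq CqK MK aK β₀) C38
      (CinvY (extraYPb (Matrix (Fin N) (Fin N) ℂ) G) f G (fun j => parKnitY (f j).toKIdx)) := by
  have hG1 := norm_le_one_of_le_unitaryUnits G hGU
  have hparG := parKnitY_mem_of_reg335C_at f c35 G (extraYPb (Matrix (Fin N) (Fin N) ℂ) G) hGa hGU hMInv hc hRP hα' hαQ hαt hKpl
  have hunitG := isUnit_deltaPrimeAY_parKnitY_of_reg335C_at f c35 G (extraYPb (Matrix (Fin N) (Fin N) ℂ) G) hGa hGU hMInv hc hRP hα' hαQ hαt hKpl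
  have hunitXG := isUnit_XY_parKnitY_of_reg335C_at f c35 G (extraYPb (Matrix (Fin N) (Fin N) ℂ) G) hGa hGU hMInv hc hRP hα' hαQ hαt hKpl
  have hQ15 := hQ15_knit (Mstar := Mstar) (extraYPb (Matrix (Fin N) (Fin N) ℂ) G) f c35 G 𝔮 𝔮s b ιB hGU hι hM₂ hrepr h𝔮 h𝔮s hMInv hc hRP hα' hαQ hKpl
  have hQL2 := hQL2_knit (Mstar := Mstar) (extraYPb (Matrix (Fin N) (Fin N) ℂ) G) f c35 G 𝔮 𝔮s b ιB hGU hι hM₂ hrepr h𝔮 h𝔮s hMInv hc hRP hα' hαQ hKpl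
  have hκQ : 0 ≤ (M₂ * ∑ j, ‖b j‖) * ((N : ℝ) ^ 4 * ((1 + 2 * ((d : ℝ) + 1)) * (1 + kCol (d + 1) (ℓ + 1) * α₀' * (2 * ((d : ℝ) + 1)))) *
      Real.exp ((ℓ : ℝ) + 4)) := by
    have := kCol_nonneg (d + 1) (ℓ + 1)
    have hb : 0 ≤ ∑ j, ‖b j‖ := Finset.sum_nonneg fun _ _ => norm_nonneg _
    positivity
  have hκQ2 : 0 ≤ (Real.sqrt (Fintype.card ι) * M₂ * ∑ j, ‖b j‖) *
      (1 * Real.sqrt (((N : ℝ) ^ 4 * ((1 + 2 * ((d : ℝ) + 1)) * (1 + kCol (d + 1) (ℓ + 1) * α₀' * (2 * ((d : ℝ) + 1))))) *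
        ((N : ℝ) ^ 4 * ((1 + 2 * ((d : ℝ) + 1)) * (1 + kCol (d + 1) (ℓ + 1) * α₀' * (2 * ((d : ℝ) + 1))))))) *
      Real.exp ((ℓ : ℝ) + 4) := by
    have hb : 0 ≤ ∑ j, ‖b j‖ := Finset.sum_nonneg fun _ _ => norm_nonneg _
    positivity
  exact sectBStepUParGQ_parSymYH_of_members (extraYPb (Matrix (Fin N) (Fin N) ℂ) G) f c35 G 𝔮 𝔮s b ιB C38 (fun j => parKnitY (f j).toKIdx)
    (fun j => C37KY G (f j) (ιB j) (R j) Cq CqK MK aK β₀) hι hG1 M₂ hM₂ hrepr hcR hcL CqK hCqK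
    (fun j => hC37_of_C37KY G (f j) (ιB j) (R j)) MInv aInv aW hMInv haInv haW hparG (fun j => hparC_of_C37KY G (f j) (ιB j) (R j)) hunitG hunitXG
    (fun j U z w => parKnitY_inv (f j).toKIdx U z w) hunitA hb₁ (c335Plaq ℓ aInv) (c335Plaq_nonneg ℓ haInv.le)
    (hreg335P_extraYPb G f ιB hι hMd aInv c35) (fun j => hC37G_of_C37KY G (f j) (ιB j) (R j)) _ hκQ hQ15 cF hcF hQ80 _ hκQ2 hQL2 cF2 hcF2 hQL280
    hMd mN hnbr hMr (cP := 2 * c335Plaq ℓ aInv) (mul_nonneg zero_le_two (c335Plaq_nonneg ℓ haInv.le))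
    (fun j α₀ U hM hα hMa hU => plaqLawY_of_reg335PlaqY G (f j) (ιB j) hG1 hU.1.1 (c335Plaq_nonneg ℓ haInv.le)
      (hreg335P_extraYPb G f ιB hι hMd aInv c35 j α₀ U hM hα hMa hU))
    (Classical.choose (exists_d261 (d := d) (ℓ := ℓ) (hd := hd) (hL := hL) (b₀ := b₀) (b₁ := b₁) (Mstar := Mstar)))
    (fun j δ α hδ _ hα hα1 hM => Classical.choose_spec (Classical.choose_spec
      (exists_d261 (d := d) (ℓ := ℓ) (hd := hd) (hL := hL) (b₀ := b₀) (b₁ := b₁) (Mstar := Mstar))) (f j) δ α hδ hα hα1.le hM)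
    h32 h33


end Knit

/-! ## §3 ★★★ The knit coded class contains the record's (3.37) pairs — for a group closed at a radius `t` -/

section Hclass

omit [∀ x : MemberY d ℓ hd hL b₀ b₁ Mstar, Fintype (geo9Y x).Site] instDS instNE in
/-- ★★★ **THE KNIT CODED CLASS CONTAINS THE RECORD's (3.37) PAIRS OVER REGULAR BASES** — `hclass_C37KY_onC` with the two knit laws discharged (`parVar337Y_parKnitY`, dag-n06-l (K1);
`parMemY_parKnitY_at`, dag-n06-c — for `G` closed under averaging AT A RADIUS `t`, the «K2-G-KNIT-N» edition: `hGa : AvgClosedAt (d+1) t (ℓ+1) G` + `hαt`, no `N`-cap at `SU(N)`; `P` is the first explicit binder here), constants `Cq = 4(d+1)e^{3(d+1)/2}`, `CqK = 4·154(d+1)`; displayed: the numerics windows, the regime bridge `hRP`, the reading `hR` of the class's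
regularity predicate, `hGa hGU`. [cite: Balaban1985BackgroundPropagators, (3.37) p.396, (3.35) p.396, p.401, (3.58) p.402, (3.19) p.393, Thm 3.4 p.400; Balaban1985Averaging, Prop. 2 p.26, Prop. 7 p.43] -/
theorem hclass_C37KY_knitAt (P : RegExtraY d ℓ hd hL b₀ b₁ Mstar (Matrix (Fin N) (Fin N) ℂ))
    (hι : ∀ (j : J) (s : BlkY (f j).toKIdx), β (f j).toKIdx.hN (f j).toKIdx.D (f j).toKIdx.hk (ιB j s) = s)
    {t : ℝ} (hGa : AvgClosedAt (d + 1) t (ℓ + 1) G) (hGU : G ≤ unitaryUnits (Matrix (Fin N) (Fin N) ℂ)) {c₀ : ℝ} (hc : c₀ ≤ 10)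
    (hRP : ∀ (j : J) (α₀ : ℝ) (U : CfgY (Matrix (Fin N) (Fin N) ℂ) (f j).toKIdx),
      (bg9YC (Matrix (Fin N) (Fin N) ℂ) G P (f j)).Reg335 c35 α₀ U → (bg9KP (Matrix (Fin N) (Fin N) ℂ) G (f j).toKIdx).Reg335 c₀ α₀ U)
    (hR : ∀ (j : J) (α₀ : ℝ) (U : CfgY (Matrix (Fin N) (Fin N) ℂ) (f j).toKIdx), (bg9YC (Matrix (Fin N) (Fin N) ℂ) G P (f j)).Reg335 c35 α₀ U → R j α₀ U)
    {α₀' : ℝ} (hα' : 0 < α₀') (hα3 : C0 (d + 1) * α₀' ≤ 1 / 3) (hα4 : 4 * α₀' ≤ c2' (d + 1) (ℓ + 1)) (hαQ : α₀' ≤ alphaQ (d + 1) (ℓ + 1))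
    (hαt : 32 * (((d + 1 : ℕ) : ℝ) + 1) * ((d + 1 : ℕ) + 4) * (((ℓ + 1 : ℕ) : ℝ)) ^ 2 * α₀' ≤ t)
    (hKpl : ∀ (j : J) (a : ℝ), 0 ≤ a → a ≤ aK → Kpl (f j).toKIdx a * (kGeo (f j).toKIdx).L ^ 4 < α₀')
    {αK : ℝ} (hsmall : Real.exp (4 * (800 * (((d + 1 : ℕ) : ℝ) + 1) ^ 2 * (((d + 1 : ℕ) : ℝ) + 4)) * α₀')
      * (1 + 8 * (131072 * (((d + 1 : ℕ) : ℝ) + 1) ^ 2) * αK) ≤ 2)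
    (hc₃ : 2 * αK ≤ c3 (d + 1) (ℓ + 1)) (hsm : 4096 * ((d + 1 : ℕ) : ℝ) * αK ≤ 1)
    {αcap : ℝ} (hcap4 : αcap ≤ 1 / 4) (hcapK : αcap ≤ αK) (hcapC : (154 * ((d : ℝ) + 1)) * αcap ≤ 1 / 2) (hcapβ : (((ℓ : ℝ) + 1) ^ 4) * αcap ≤ β₀) :
    ∀ (j : J) (α₀ α₁ : ℝ) (U U' : (bg9YC (Matrix (Fin N) (Fin N) ℂ) G P (f j)).Cfg), max (2 * ((d : ℝ) + 1) + 1) MK ≤ (geo9Y (f j)).M → 0 < α₀ →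
      (geo9Y (f j)).M * α₀ ≤ aK → (bg9YC (Matrix (Fin N) (Fin N) ℂ) G P (f j)).Reg335 c35 α₀ U → 0 < α₁ → α₁ ≤ αcap →
      (bg9YC (Matrix (Fin N) (Fin N) ℂ) G P (f j)).Cplx337 α₁ U U' →
      ∃ a : (codingYx P G (f j) (C37KY G (f j) (ιB j) (R j) (4 * ((d : ℝ) + 1) * Real.exp (3 * (((d : ℝ) + 1) / 2))) (4 * (154 * ((d : ℝ) + 1))) MK aK β₀) (C38 j)).A,
        (codingYx P G (f j) (C37KY G (f j) (ιB j) (R j) (4 * ((d : ℝ) + 1) * Real.exp (3 * (((d : ℝ) + 1) / 2))) (4 * (154 * ((d : ℝ) + 1))) MK aK β₀) (C38 j)).decA a = U' ∧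
        (codingYx P G (f j) (C37KY G (f j) (ιB j) (R j) (4 * ((d : ℝ) + 1) * Real.exp (3 * (((d : ℝ) + 1) / 2))) (4 * (154 * ((d : ℝ) + 1))) MK aK β₀) (C38 j)).C37
          ((((ℓ : ℝ) + 1) ^ 4) * α₁) U a := by
  have hCp : (0 : ℝ) ≤ 154 * ((d : ℝ) + 1) := by positivity
  have hM : ∀ j, 0 ≤ (kGeo (f j).toKIdx).M := fun j => by
    show (0 : ℝ) ≤ ((ℓ + 1 : ℕ) : ℝ) * ((f j).toKIdx.Mh : ℝ); positivity
  exact hclass_C37KY_onC P f G ιB C38 R (fun j α₀ U => (bg9KP (Matrix (Fin N) (Fin N) ℂ) G (f j).toKIdx).Reg335 c₀ α₀ U) hι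
    (norm_le_one_of_le_unitaryUnits G hGU) c35 hCp
    (fun j => parVar337Y_parKnitY (f j).toKIdx hGU hc hα' hα3 hα4 (hKpl j) hsmall hc₃ hsm)
    (fun j => parMemY_parKnitY_at G (f j).toKIdx hGa hGU (hM j) hc hα' hαQ hαt (hKpl j)) hR hRP hcap4 hcapK hcapC hcapβ


end Hclass

end Summit.QuantumFields.YangMills.BalabanUVNodes.N06SectBStepUParKnitAt

end
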